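import Mathlib
import Literature.Barriers.ValiantsHypothesis.AlgebraicNaturalProofs
import Summits.ValiantsHypothesis.ValiantsHypothesis.Theorems.BarrierLeverPartitionMinorsHitByVPSimplexJoinDoor
import Summits.ValiantsHypothesis.ValiantsHypothesis.Theorems.BarrierLeverPartitionMinorsHitByVPOfLowerSets
import Summits.ValiantsHypothesis.ValiantsHypothesis.Theses.BarrierLever

/-!
# Route BarrierLever — item `PartitionMinorsHitByVP` (stmt-ValiantsHypothesis-19717):
# typed NODES for the simplex-product join door and the item BY NAME

Link file (`--supports stmt-ValiantsHypothesis-19717`; cell valiant-natproofs, rung V4, 𝒟-side door (c), line `hidden_states`;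
prover seat val-np-p3 gen 11). Two typed statements (plain `Prop` defs in the cell's one-exchange format; NOT asserted) and
their kernel-checked compositions with the exact-support door `SimplexJoin.partitionMinor_hit_of_simplexJoin_mem`
(`…SimplexJoinDoor`, p610558; here also its WIDE class form `N ≤ (2h)²`, `b = 10`) and the lower-set reduction `DownCompression.exists_smallCircuit_of_lowerSets`.

* `Stmt.simplexUniversal` — ONE simplex-product design per `(h, r)` (`m ≤ (2h)²` pieces, depth `≤ 2h`, width `≤ (2h)²`, exact
  live enumeration) good for EVERY injective row family; `partitionMinorsHitByVP_of_simplexUniversal` (`b = 10`).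
* `Stmt.simplexPairLower` — for every PAIR of injective LOWER families one design (depending on the pair) good on both sides;
  `partitionMinorsHitByVP_of_simplexPairLower` (`b = 14`); `simplexPairLower_of_simplexUniversal`.

STATUS: conjectural. The base-`(h+1)` digit join is NOT universal (affine-dependence obstruction, `…SimplexJoinDoor` header;
kit j300341: first failure `h = 9`, `r = 100`); designs with depth `≈ D_min/2` and factors of `≈ h²` vertices, or with decaying
factor sizes, pass every obstruction the seat knows ((H) Hilbert, (O1) translate, (O2) affine-dependence tensors) and are the live candidates. WHAT THIS IS NOT: no
claim that either node holds; item 19717 stays OPEN; nothing on crux 14610 or VP ≠ VNP.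
-/

set_option linter.dupNamespace false

namespace Summit.ValiantsHypothesis.ValiantsHypothesis.Theorems.BarrierLever.SimplexJoin

open Finset MvPolynomial Matrix
open Literature.Barriers.ValiantsHypothesis Literature.Computability.AlgebraicComplexity

noncomputable section

variable {h : ℕ}

/-! ## Class form with WIDE factors (`N ≤ (2h)²`) -/

/-- **The simplex-product join door, wide class form.** With `m ≤ (2h)²` pieces, depth `D ≤ 2h`, width `N ≤ (2h)²`
(simplices with up to `4h² + 1` vertices — the factor sizes the affine-dependence obstruction asks for) and `h ≥ 3`, the
witness lies in `SmallCircuits ℂ (h+h) 10`. -/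
theorem partitionMinor_hit_of_simplexJoin_mem_wide (h m D N r : ℕ) (hh : 3 ≤ h) (hm : m ≤ (h + h) ^ 2)
    (hD : D ≤ h + h) (hN : N ≤ (h + h) ^ 2) (u w : Fin r → Finset (Fin h))
    (S : Fin m → Fin D → Finset (Fin N))
    (e : Fin r → Fin m × (Fin D → Option (Fin N))) (he : Function.Injective e)
    (hlive : ∀ c : Fin m × (Fin D → Option (Fin N)),
      c ∈ Set.range e ↔ ∀ (f : Fin D) (j : Fin N), c.2 f = some j → j ∈ S c.1 f)
    (tx ty : Fin m → Option (Fin D × Fin N) → Fin h → ℂ)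
    (hx : (Matrix.of fun i k : Fin r => ∏ a ∈ u i,
      (tx (e k).1 none a + ∑ f : Fin D, ((e k).2 f).elim 0 fun j => tx (e k).1 (some (f, j)) a)).det ≠ 0)
    (hy : (Matrix.of fun i k : Fin r => ∏ c ∈ w i,
      (ty (e k).1 none c + ∑ f : Fin D, ((e k).2 f).elim 0 fun j => ty (e k).1 (some (f, j)) c)).det ≠ 0) :
    ∃ F ∈ SmallCircuits ℂ (h + h) 10,
      (Matrix.of fun i j : Fin r => MvPolynomial.coeff
        (∑ a ∈ u i, Finsupp.single (Fin.castAdd h a) 1 +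
          ∑ c ∈ w j, Finsupp.single (Fin.natAdd h c) 1) F).det ≠ 0 := by
  obtain ⟨F, hdeg, hsize, hF⟩ := partitionMinor_hit_of_simplexJoin h m D N r u w S e he hlive tx ty hx hy
  refine ⟨F, ⟨hdeg, hsize.trans ?_⟩, hF⟩
  set H := h + h with hH
  have hH6 : 6 ≤ H := by omega
  have hHpos : 0 < H := by omega
  have hP : 3 * H + (D * (N * (3 * H) + N + 1) + D) + 1 ≤ 4 * H ^ 4 := by
    calc 3 * H + (D * (N * (3 * H) + N + 1) + D) + 1
        ≤ 3 * H + (H * (H ^ 2 * (3 * H) + H ^ 2 + 1) + H) + 1 := by gcongr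
      _ = 3 * H ^ 4 + H ^ 3 + 5 * H + 1 := by ring
      _ ≤ 3 * H ^ 4 + H ^ 4 := by nlinarith [pow_le_pow_left₀ (Nat.zero_le 6) hH6 2, pow_le_pow_left₀ (Nat.zero_le 6) hH6 3]
      _ = 4 * H ^ 4 := by ring
  have hsq : (H + 2) ^ 2 ≤ 2 * H ^ 2 := by nlinarith
  have h48 : H ^ 4 ≤ H ^ 8 := Nat.pow_le_pow_right hHpos (by norm_num)
  have h18 : H ≤ H ^ 8 := by
    calc H = H ^ 1 := (pow_one H).symm
      _ ≤ H ^ 8 := Nat.pow_le_pow_right hHpos (by norm_num)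
  have h08 : 1 ≤ H ^ 8 := Nat.one_le_pow _ _ hHpos
  have h12 : 12 ≤ H ^ 2 := by nlinarith
  calc (H + 2) ^ 2 * (m * (3 * H + (D * (N * (3 * H) + N + 1) + D) + 1) + m) + (H + 1)
      ≤ (2 * H ^ 2) * (H ^ 2 * (4 * H ^ 4) + H ^ 2) + (H + 1) := by gcongr
    _ = 8 * H ^ 8 + 2 * H ^ 4 + H + 1 := by ring
    _ ≤ 8 * H ^ 8 + 2 * H ^ 8 + H ^ 8 + H ^ 8 := by gcongr
    _ = 12 * H ^ 8 := by ring
    _ ≤ H ^ 2 * H ^ 8 := Nat.mul_le_mul_right _ h12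
    _ = H ^ 10 := by ring

/-! ## The item from simplex-product designs (by name) -/

/-- **THE PAIR NODE FOR SIMPLEX-PRODUCT DESIGNS, on lower sets (statement).** For all large `h` and every pair
`(u, w)` of injective LOWER families of `r` subsets of `Fin h` there is ONE simplex-product design
(`m ≤ (2h)²` pieces, depth `D ≤ 2h`, width `N ≤ (2h)²`, live sets `S`, exact enumeration `e` of the live columns)
that is GOOD on the `u`-side and on the `w`-side. No weights, no threshold legality. -/
def Stmt.simplexPairLower : Prop :=
  ∃ h₁ : ℕ, ∀ h : ℕ, h₁ ≤ h → ∀ (r : ℕ) (u w : Fin r → Finset (Fin h)),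
    Function.Injective u → Function.Injective w → IsLowerSet (Set.range u) → IsLowerSet (Set.range w) →
    ∃ (m D N : ℕ) (S : Fin m → Fin D → Finset (Fin N)) (e : Fin r → Fin m × (Fin D → Option (Fin N))),
      m ≤ (h + h) ^ 2 ∧ D ≤ h + h ∧ N ≤ (h + h) ^ 2 ∧ Function.Injective e ∧
      (∀ c : Fin m × (Fin D → Option (Fin N)),
        c ∈ Set.range e ↔ ∀ (f : Fin D) (j : Fin N), c.2 f = some j → j ∈ S c.1 f) ∧
      (∃ tx : Fin m → Option (Fin D × Fin N) → Fin h → ℂ,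
        (Matrix.of fun i k : Fin r => ∏ a ∈ u i,
          (tx (e k).1 none a + ∑ f : Fin D, ((e k).2 f).elim 0 fun j => tx (e k).1 (some (f, j)) a)).det ≠ 0) ∧
      (∃ ty : Fin m → Option (Fin D × Fin N) → Fin h → ℂ,
        (Matrix.of fun i k : Fin r => ∏ c ∈ w i,
          (ty (e k).1 none c + ∑ f : Fin D, ((e k).2 f).elim 0 fun j => ty (e k).1 (some (f, j)) c)).det ≠ 0)

/-- **THE UNIVERSAL NODE FOR SIMPLEX-PRODUCT DESIGNS (statement).** For all large `h` and every `r ≤ 2^h` ONE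
simplex-product design of size `r` is GOOD for EVERY injective row family (candidate: the base-`(h+1)` digit join). -/
def Stmt.simplexUniversal : Prop :=
  ∃ h₁ : ℕ, ∀ h : ℕ, h₁ ≤ h → ∀ r : ℕ, r ≤ 2 ^ h →
    ∃ (m D N : ℕ) (S : Fin m → Fin D → Finset (Fin N)) (e : Fin r → Fin m × (Fin D → Option (Fin N))),
      m ≤ (h + h) ^ 2 ∧ D ≤ h + h ∧ N ≤ (h + h) ^ 2 ∧ Function.Injective e ∧
      (∀ c : Fin m × (Fin D → Option (Fin N)),
        c ∈ Set.range e ↔ ∀ (f : Fin D) (j : Fin N), c.2 f = some j → j ∈ S c.1 f) ∧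
      ∀ u : Fin r → Finset (Fin h), Function.Injective u →
        ∃ tx : Fin m → Option (Fin D × Fin N) → Fin h → ℂ,
          (Matrix.of fun i k : Fin r => ∏ a ∈ u i,
            (tx (e k).1 none a + ∑ f : Fin D, ((e k).2 f).elim 0 fun j => tx (e k).1 (some (f, j)) a)).det ≠ 0

/-- The universal node implies the pair node (same design for `u` and `w`; lower-set hypotheses unused). -/
theorem simplexPairLower_of_simplexUniversal (H : Stmt.simplexUniversal) : Stmt.simplexPairLower := by
  obtain ⟨h₁, H⟩ := H
  refine ⟨h₁, fun h hh r u w hu hw _ _ => ?_⟩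
  have hr : r ≤ 2 ^ h := by
    have := Fintype.card_le_of_injective u hu
    rwa [Fintype.card_fin, Fintype.card_finset, Fintype.card_fin] at this
  obtain ⟨m, D, N, S, e, hm, hD, hN, he, hlive, Hu⟩ := H h hh r hr
  exact ⟨m, D, N, S, e, hm, hD, hN, he, hlive, Hu u hu, Hu w hw⟩

/-- **The item from the universal node** (`b = 10`, through `partitionMinor_hit_of_simplexJoin_mem_wide`). -/
theorem partitionMinorsHitByVP_of_simplexUniversal (H : Stmt.simplexUniversal) :
    Summit.ValiantsHypothesis.ValiantsHypothesis.Theses.BarrierLever.PartitionMinorsHitByVP := by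
  obtain ⟨h₁, H⟩ := H
  refine ⟨10, max h₁ 3, fun h hh r u w hu hw => ?_⟩
  have hh₁ : h₁ ≤ h := le_trans (le_max_left _ _) hh
  have hh3 : 3 ≤ h := le_trans (le_max_right _ _) hh
  have hr : r ≤ 2 ^ h := by
    have := Fintype.card_le_of_injective u hu
    rwa [Fintype.card_fin, Fintype.card_finset, Fintype.card_fin] at this
  obtain ⟨m, D, N, S, e, hm, hD, hN, he, hlive, Hu⟩ := H h hh₁ r hr
  obtain ⟨tx, hx⟩ := Hu u hu
  obtain ⟨ty, hy⟩ := Hu w hw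
  exact partitionMinor_hit_of_simplexJoin_mem_wide h m D N r hh3 hm hD hN u w S e he hlive tx ty hx hy

/-- **The item from the pair node on lower sets** (`b = 14`: the wide door at `b = 10`, then the lower-set reduction
`DownCompression.exists_smallCircuit_of_lowerSets`, +4). -/
theorem partitionMinorsHitByVP_of_simplexPairLower (H : Stmt.simplexPairLower) :
    Summit.ValiantsHypothesis.ValiantsHypothesis.Theses.BarrierLever.PartitionMinorsHitByVP := by
  obtain ⟨h₁, H⟩ := H
  refine ⟨10 + 4, max (max h₁ 3) 4, fun h hh r u w hu hw => ?_⟩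
  refine Summit.ValiantsHypothesis.ValiantsHypothesis.Theorems.BarrierLever.DownCompression.exists_smallCircuit_of_lowerSets
    10 (max h₁ 3) (fun h' hh' r' v w' hv hw' hlv hlw' => ?_) h hh r u w hu hw
  have hh₁ : h₁ ≤ h' := le_trans (le_max_left _ _) hh'
  have hh3 : 3 ≤ h' := le_trans (le_max_right _ _) hh'
  obtain ⟨m, D, N, S, e, hm, hD, hN, he, hlive, ⟨tx, hx⟩, ⟨ty, hy⟩⟩ := H h' hh₁ r' v w' hv hw' hlv hlw'
  exact partitionMinor_hit_of_simplexJoin_mem_wide h' m D N r' hh3 hm hD hN v w' S e he hlive tx ty hx hy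

end

end Summit.ValiantsHypothesis.ValiantsHypothesis.Theorems.BarrierLever.SimplexJoin
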